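import Summits.BirchSwinnertonDyer.BirchSwinnertonDyer.Theorems.AdditiveKolyvaginRoadManinFrameResidueProperROfKatoLTwist
import Summits.BirchSwinnertonDyer.BirchSwinnertonDyer.Theorems.EdixhovenFibreFiveSevenTwistDegreeStepFiveSevenLTwistAssembly
import HarnessLib

/-!
# Route `AdditiveKolyvaginRoad`, crux `ManinFrameResidueProperR` (stmt-BirchSwinnertonDyer-20709), line
# `tame_twist`: the crux BY NAME from PUBLISHED statement-only inputs — F″ (Kato), three-copy Ihara
# (Diamond–Ribet), and the Chebotarev non-Eisenstein witness (`--supports`, CONDITIONAL)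

Cell `pub/bsd-wall`, seat `bsd-wall-manin-p1` (g6). THEOREMS ONLY (no definition, no named fact, no `sorry`).
Nothing is closed unconditionally and BSD is not proved by this file.

`ManinFrameResidueProperROfKatoLTwist.maninFrameResidueProperR_of_kato_of_lTwist` (this seat, p590858) is
`F″ → L-TWIST → ManinFrameResidueProperR` (skeleton v3 of line `tame_twist` with both stubs substituted; TORS-TWIST
discharged by `TorsTwist.torsTwist`, p589688). The L-TWIST hypothesis — the twisted-period decomposition
`Λ(f) ⊆ s·Λ(f ⊗ χ_{q*}) + p·Λ(f)` — is now the theorem `LTwist.lTwist_of_iharaSq_of_witness` of the sibling line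
`EdixhovenFibreFiveSeven` (seats `bsd-line-edix-p2/p3/p4`, p591838), GRANTED the cite-only three-copy Ihara lemma
`ModularForms.diamondRibet1997_iharaLemma_sq` (Diamond–Ribet 1997 Lemma 4.6, `m_p = 2`; Darmon–Diamond–Taylor 1995
§4.5) and a Chebotarev-type non-Eisenstein witness `hW` (a prime `r₀ ≡ 1 mod S` with `a_{r₀} ≢ r₀ + 1 mod p` for
`E[p]` irreducible; being PROVED from the tree's `chebotarev_geomTorsion` by seat `bsd-line-edix-p5`). Composing:

  `maninFrameResidueProperR_of_kato_of_iharaSq_of_witness : F″ → Ihara³ → hW → ManinFrameResidueProperR`.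

So crux #7 of route `AdditiveKolyvaginRoad` is CONDITIONAL on published, statement-only inputs only:
F″ = `kato_neron_isIntegral_twistedSymbolSum_of_additive_five_le` (Kato 2004 (8.1.3)/Thm 9.7/Thm 6.6 + Kim–Nakamura
2020 Cor. 2.4), Ihara³, and the Chebotarev witness. The item is NOT closed by this (conditional-result).

References: [Kato2004Asterisque] (8.1.3), Thm. 9.7, Thm. 6.6; [KimNakamura2020] Cor. 2.4; [DiamondRibet1997] Lemma 4.6;
[DarmonDiamondTaylor1995] §4.5 p. 137; [Stevens1989] §5; [SilvermanAEC2009] III.8.1, X.5 Cor. 5.4.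
-/

set_option autoImplicit false
-- the Theorems directory repeats the summit name (sibling precedent `SignedBaseChangeAssembly.lean`)
set_option linter.dupNamespace false

noncomputable section

open scoped Classical MatrixGroups

open WeierstrassCurve NumberField Literature.NumberTheory.EllipticCurves
  Literature.NumberTheory.EllipticCurves.ModularForms
  Literature.NumberTheory.EllipticCurves.Rank1Residual
  Summit.BirchSwinnertonDyer.BirchSwinnertonDyer.Theorems
  Summit.BirchSwinnertonDyer.BirchSwinnertonDyer.Theses.AdditiveKolyvaginRoad

namespace Summit.BirchSwinnertonDyer.BirchSwinnertonDyer.Theorems.ManinFrameResidueProperROfKatoLTwist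

/-- **Crux `ManinFrameResidueProperR` (stmt-BirchSwinnertonDyer-20709) BY NAME, GRANTED F″ (`hK`, Kato), the
three-copy Ihara lemma (`hI`, Diamond–Ribet / Darmon–Diamond–Taylor, cite-only) and the Chebotarev non-Eisenstein
witness (`hW`).** One line: `maninFrameResidueProperR_of_kato_of_lTwist hK (LTwist.lTwist_of_iharaSq_of_witness hI hW)`.
CONDITIONAL; the item is not closed by this; BSD is not proved by this.
[cite: Kato2004Asterisque, (8.1.3) (p. 180), Thm. 9.7 (p. 189)] [cite: DiamondRibet1997, §4.4 Lemma 4.6]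
[cite: DarmonDiamondTaylor1995, §4.5 p. 137] -/
theorem maninFrameResidueProperR_of_kato_of_iharaSq_of_witness
    (hK : kato_neron_isIntegral_twistedSymbolSum_of_additive_five_le)
    (hI : diamondRibet1997_iharaLemma_sq)
    (hW : ∀ (W : WeierstrassCurve ℚ) [W.IsElliptic] [W.IsGloballyMinimal] (p : ℕ) [Fact p.Prime] (S : ℕ),
      p ≠ 2 → Irr W p → S ≠ 0 →
      ∃ r₀ : ℕ, r₀.Prime ∧ ¬ r₀ ∣ S ∧ r₀ ≡ 1 [MOD S] ∧ ¬ (p : ℤ) ∣ W.LFunction r₀ - (r₀ + 1)) :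
    ManinFrameResidueProperR :=
  maninFrameResidueProperR_of_kato_of_lTwist hK (LTwist.lTwist_of_iharaSq_of_witness hI hW)

end Summit.BirchSwinnertonDyer.BirchSwinnertonDyer.Theorems.ManinFrameResidueProperROfKatoLTwist

end
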